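import Summits.QuantumFields.BalabanUV.T4Continuum.Support.NE7ApeCurvedRepRoadBLandauB8CorrEnd
import Summits.QuantumFields.BalabanUV.T4Continuum.Support.NE7LandauB8HarmonicExtensionOfRows
import HarnessLib

/-!
# NE7ApeCurvedRepRoadBSmoothInverseEnd — THE END OF RECORD AFTER F182: the curved (APE) with a datum on road (B) ⇐ E′ regime + class data + regime lines + (L1)′ names +
# **(KL-B)** (the curl row of Bałaban's constrained 1-form propagator on `ker QbarIter_W` in [B9]'s `R(U)`-gauge = `IsLandauB8`; NE9's rows) + **(T1♯)** (an EXACT right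
# inverse of the nested transported block mean `bmeanIterW L (j+1) W` with sup `C_a` and covariant-Laplacian sup `C_a′` — pure approximation theory at the curved background);
# BOTH scalar gauge rows (R-H8), (R-C8) of F178 are now DISCHARGED modulo (T1♯): `C_H := C_a + 36d(frameC+d)²M²c_RE·C_a′`, `C_b := 36d(frameC+d)²M²c_RE`
# (file 113 of the curved (APE), F183)

Cell `pub-balaban`, rung (B)+1 sub-cell t4, lineage `b2b-balaban-t4-ne7-p1` (CRUX PROVER NE7 #1 = OWNER of row NE7), generation 84; memo
`t4/b2b-balaban-t4-ne7-p1-g84/SCALAR-ROWS.md`.  Over F181 `NE7ApeCurvedRepRoadBLandauB8CorrEnd.smallField_of_tanCritical_roadB_landauB8_corr_end`, F182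
`NE7LandauB8HarmonicExtensionOfRows.harmonicExtensionRow_of_smoothRightInverse` and F180 `NE7LandauB8CorrectionRow.landauB8CorrectionLetter_of_fluxGrad` BY NAME.
WHAT ([folklore]; 0 def, 0 sorry).  **`smallField_of_tanCritical_roadB_smoothInverse_end`** — F181 with the binder `hRH` replaced by (T1♯) `hT` and `C_H` by
`C_a + 36d(frameC+d)²(L^{j+1})²c_RE·C_a′`.
POWER COUNTING (memo g83 §5 ∕ g84 SCALAR-ROWS §2): with `C_a ≍ 1`, `C_a′ ≍ 1∕M²` (a `C¹` squared-tent right inverse) `C_H ≍ 1 + 36d(frameC+d)²c_RE` is k-UNIFORM (volume-dependent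
through `c_RE` exactly like the END's own regime lines) — the order the class-radii line accepts.
HONEST FRAMING (page 1): composition; (KL-B) and (T1♯) are HYPOTHESIS SHAPES (NOT proved here: (KL-B) = NE9's [B9] Thm 3.1–3.3∕(3.49)∕3.11 rows behind the wall O-NE9-1;
(T1♯) = the sequel's construction); the discharged constants are VOLUME-DEPENDENT (`c_RE ∝ N^d`); nothing of Bałaban's asserted; (APE) on curved data NOT proved; NOT ONE-STEP,
NOT NE7; spine 0∕9; finite T⁴ rung (B)+1 — NOT infinite volume, NOT mass gap, NOT `BetaPertH`, NOT Clay.  Continuum YM on T⁴ ⇐ BetaPertH ∧ nine spine estimates (0/9 proved);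
BetaPertH ⇐ (D1) ∧ (D4) ∧ CAP+tail; G-an2-4 gates asym, D1 and NE2/3/4.
-/

set_option autoImplicit false

open scoped BigOperators Matrix Matrix.Norms.L2Operator
open NormedSpace Finset

namespace Summit.QuantumFields.BalabanUV.T4Continuum.NE7ApeCurvedRepRoadBSmoothInverseEnd

open Literature.MathematicalPhysics.QuantumFieldTheory.Balaban1983to89
open B7Prop1Explicit B7Prop2Explicit MatrixLog UnitaryModel
open T4AveragingDeficitWall (Ad IsUnitaryCfg IsSkewDir SmallField vary curlAt dirL1 flux covGrad)
open T4AveragingDeficitWallBoundary (IsPeriodicCfg periodBox)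
open AveragingDeficitPeriodicCounting (IsPeriodicDir)
open AveragingDeficitTwoLevelPrep (twoLevelSmall)
open AveragingDeficitMultiLevelPrep (cavgIter LevelSmall)
open MinimalActionLevels (perWin)
open BlockAverageVaryHolo (nbRad)
open BlockAveragePushDirGauge (gaugeDir)
open NE3HessForm (hess dAction)
open NE3TangentCovariantTower (dirIter QbarIter)
open NE3EnergyShapes (IsUnitarySite IsPeriodicSite)
open NE3CovariantWeitzenbock (covDiv)
open NE3RightInverseSupLetters (frameC supC corrC)
open NE3QbarIterCovLiftPrep (cruxC)
open NE3RightInverseSolveLetters (thetaLoc)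
open NE3HatInvCurlLetters (curl1C)
open BlockAverageVaryDisc (rho0)
open NE3LinearisedAverageSup (curvSum)
open NE7ApeCurvedRepRoadBLandauB8CorrEnd (smallField_of_tanCritical_roadB_landauB8_corr_end)
open NE7LandauB8HarmonicExtensionOfRows (harmonicExtensionRow_of_smoothRightInverse)
open NE3.PairLandauB8 (covLapSite)
open NE7LandauB8CorrectionRow (landauB8CorrectionLetter_of_fluxGrad)
open NE3CovariantBlockMean (bmeanIterW)
open NE3.PairLandauB8 (avgKernelGauges)

open NE3.PairLandauB8 (IsLandauB8)

noncomputable section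

variable {d : ℕ} {n : Type*} [Fintype n] [DecidableEq n]
set_option maxHeartbeats 400000 in
/-- **THE CURVED (APE) WITH A DATUM ON (KL-B) + (T1♯)**: F181 `smallField_of_tanCritical_roadB_landauB8_corr_end` with its letter `hRH` SUPPLIED by F182
`harmonicExtensionRow_of_smoothRightInverse` over (T1♯) and F180's (R-C8) (`C_H = C_a + 36d(frameC+d)²(L^{j+1})²c_RE·C_a′`). [folklore] -/
theorem smallField_of_tanCritical_roadB_smoothInverse_end [Nonempty n] (hd : 2 ≤ d) {L N : ℕ} [NeZero N] (hL : 2 ≤ L) (j : ℕ)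
    -- the background
    {W : Site d → Fin d → (Matrix n n ℂ)ˣ} {x : ℝ} (hWu : IsUnitaryCfg W) (hWP : IsPeriodicCfg W ((N * L ^ (j + 1) : ℕ) : ℤ))
    (hx : 0 ≤ x) (hs : LevelSmall d L j x) (hWx : SmallField W x)
    -- the sup radius of the representative and the regime at `x′ = x + 4(e^{α₀} − 1)`
    {α₀ : ℝ} (hα0 : 0 ≤ α₀) (hs' : LevelSmall d L j (x + 4 * (Real.exp α₀ - 1)))
    (hθ : cruxC d L * (((L : ℝ) ^ (j + 1)) ^ 2 * (x + 4 * (Real.exp α₀ - 1))) < 1)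
    (hθl : thetaLoc d L * (((L : ℝ) ^ (j + 1)) ^ 2 * (x + 4 * (Real.exp α₀ - 1))) < 1)
    (hε : ((L : ℝ) ^ (j + 1)) ^ 2 * (x + 4 * (Real.exp α₀ - 1)) ≤ 1)
    -- the field: of the class, tangent-critical, over `W`'s datum
    {U : Site d → Fin d → (Matrix n n ℂ)ˣ} (hUu : IsUnitaryCfg U) (hUP : IsPeriodicCfg U ((N * L ^ (j + 1) : ℕ) : ℤ))
    {xU : ℝ} (hxU : 0 ≤ xU) (hsU : LevelSmall d L j xU) (hUxU : SmallField U xU)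
    (hcritU : ∀ Y : Site d → Fin d → Matrix n n ℂ, IsSkewDir Y → IsPeriodicDir Y ((N * L ^ (j + 1) : ℕ) : ℤ) →
      dirIter L (j + 1) U Y = 0 → dAction U Y (perWin d (N * L ^ (j + 1))) = 0)
    (hTopUW : cavgIter L (j + 1) U = cavgIter L (j + 1) W)
    -- row NE3's class data of `W` and E′'s initial gauge ∕ regime (as in `exists_landauRep_W`), the constant `c_RE` named; road (B)'s two extra regime lines
    -- the FLUX-GRADIENT radii of `W` and `U` (row NE3's `RegularSup` datum; (1.8)∕(1.9) TYPE via `NE3FluxGradientDictionary` ∕ `MinimalActionClassSix`)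
    {gW gU : ℝ} (hgW : ∀ (z : Site d) (μ : Fin d) (π : T4AveragingDeficitWall.Plane d), ‖T4AveragingDeficitWall.covGrad W (T4AveragingDeficitWall.flux W) z μ π‖ ≤ gW)
    (hgU : ∀ (z : Site d) (μ : Fin d) (π : T4AveragingDeficitWall.Plane d), ‖T4AveragingDeficitWall.covGrad U (T4AveragingDeficitWall.flux U) z μ π‖ ≤ gU)
    (hbx : 23040 * (d : ℝ) ^ 4 * (frameC d L + d) ^ 2 * ((L : ℝ) ^ (j + 1)) ^ 2 * x ≤ 1)
    (hcx : 11520 * (d : ℝ) ^ 4 * (frameC d L + d) ^ 3 * ((L : ℝ) ^ (j + 1)) ^ 3 * (2 * gW) ≤ 1)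
    (hbx' : 256 * (d : ℝ) ^ 2 * ((L : ℝ) ^ (j + 1)) ^ 2 * x ≤ 1) (hcx' : 16 * (d : ℝ) * ((L : ℝ) ^ (j + 1)) ^ 3 * (2 * gW) ≤ 1)
    {r₀ b₀ : ℝ} (hr₀ : ∀ (y : Site d) (μ : Fin d), ‖(((W y μ)⁻¹ * U y μ : (Matrix n n ℂ)ˣ) : (Matrix n n ℂ)) - 1‖ ≤ r₀)
    (hb₀ : ∀ x : Site d, ‖covDiv W (fun y μ => mlog (((W y μ)⁻¹ * U y μ : (Matrix n n ℂ)ˣ) : (Matrix n n ℂ))) x‖ ≤ b₀)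
    {cRE : ℝ} (hcRE : cRE = 1 + 2 * (Fintype.card n : ℝ) * (64 * (d : ℝ) ^ 2 * N) ^ d + 27 * (Fintype.card n : ℝ) ^ 3 * (512 : ℝ) ^ d * (N : ℝ) ^ d)
    (hreg₁ : (36 * (d : ℝ) * (frameC d L + d) ^ 2) * ((L : ℝ) ^ (j + 1)) ^ 2 * (cRE * b₀) ≤ 1 / 10)
    (hreg₂ : (36 * (d : ℝ) * (frameC d L + d)) * (L : ℝ) ^ (j + 1) * (cRE * b₀) ≤ 1 / 25)
    (hreg₃ : r₀ + 5 / 2 * ((36 * (d : ℝ) * (frameC d L + d)) * (L : ℝ) ^ (j + 1) * (cRE * b₀)) ≤ 1 / 20)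
    (hline : cRE * (4 * ((36 * (d : ℝ) * (frameC d L + d) ^ 2) * ((L : ℝ) ^ (j + 1)) ^ 2) * (b₀ + 4 * (cRE * b₀))
        + 25 * d * (r₀ + 5 / 2 * ((36 * (d : ℝ) * (frameC d L + d)) * (L : ℝ) ^ (j + 1) * (cRE * b₀))) * ((36 * (d : ℝ) * (frameC d L + d)) * (L : ℝ) ^ (j + 1))
        + 14 * d * ((36 * (d : ℝ) * (frameC d L + d)) * (L : ℝ) ^ (j + 1)) ^ 2 * (cRE * b₀)) ≤ 1 / 2)
    -- E′'s radii named: `α_E`, `θ_u`; the tent extension's `δ = corrC∕M·2θ_u`; road (B)'s regime `α_E ≤ 1∕40`, `θ_u ≤ 1∕160`, `δ ≤ 1∕40`, `α₀ ≥ α_E + δ + 4(2θ_u+δ)(α_E+δ)`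
    {αE θu : ℝ} (hαE : αE = 2 * (r₀ + 5 / 2 * ((36 * (d : ℝ) * (frameC d L + d)) * (L : ℝ) ^ (j + 1) * (cRE * b₀))))
    (hθu : θu = 4 * ((36 * (d : ℝ) * (frameC d L + d) ^ 2) * ((L : ℝ) ^ (j + 1)) ^ 2 * (cRE * b₀)))
    (hαE40 : αE ≤ 1 / 40) (hθu160 : θu ≤ 1 / 160)
    {δ : ℝ} (hδ : δ = corrC d / (L : ℝ) ^ (j + 1) * (2 * θu)) (hδ40 : δ ≤ 1 / 40) (hα₀ : αE + δ + 4 * (2 * θu + δ) * (αE + δ) ≤ α₀)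
    -- the remaining analytic letters at `W`: (L1)′ and α₁ for the SAME-TOP structured fields of radius `α₀`, (L2), (L3) discharged
    -- (L1)′ DISCHARGED (F111): the quadratic-remainder regime, the slice `S` containing the `W`-tangent skew periodic fields, and the names `c_N = 4m`, `ν = 24·#Plane·m`
    (hs1 : LevelSmall d L (j + 1) x) (hA : curvSum d L (j + 1) x ≤ 2 / 3 * L) (hσ0 : 4 * (3 + 12 * (d : ℝ)) ^ 2 * (L : ℝ) ^ (j + 1) * α₀ ≤ rho0 d L ^ 2)
    {cN aN ν : ℝ}
    (haN : aN = (supC d L / ((L : ℝ) ^ (j + 1) * (1 - cruxC d L * (((L : ℝ) ^ (j + 1)) ^ 2 * x)))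
        * (4 * (3 + 12 * (d : ℝ)) ^ 3 / rho0 d L ^ 2 * ((L : ℝ) ^ (j + 1) * α₀) ^ 2)))
    (hcN : cN = 4 * (supC d L / ((L : ℝ) ^ (j + 1) * (1 - cruxC d L * (((L : ℝ) ^ (j + 1)) ^ 2 * x)))
        * (4 * (3 + 12 * (d : ℝ)) ^ 3 / rho0 d L ^ 2 * ((L : ℝ) ^ (j + 1) * α₀) ^ 2)))
    (hνm : ν = 24 * (Fintype.card (T4AveragingDeficitWall.Plane d) : ℝ) * (supC d L / ((L : ℝ) ^ (j + 1) * (1 - cruxC d L * (((L : ℝ) ^ (j + 1)) ^ 2 * x)))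
        * (4 * (3 + 12 * (d : ℝ)) ^ 3 / rho0 d L ^ 2 * ((L : ℝ) ^ (j + 1) * α₀) ^ 2)))
    -- `x ≤ 1/4` (F141's regime; implied by `hbx'` when `d ≥ 2`, kept displayed for a one-line discharge)
    (hx4 : x ≤ 1 / 4)
    -- (KL-B): THE ONE-TERM LETTER ON BAŁABAN's STRAIGHT SLICE `ker QbarIter_W` IN [B9]'s `R(U)`-GAUGE = `IsLandauB8` (NE9's `RofUk`)
    {KB : ℝ}
    (hB : ∀ X'' : Site d → Fin d → Matrix n n ℂ, IsSkewDir X'' → IsPeriodicDir X'' ((N * L ^ (j + 1) : ℕ) : ℤ) → QbarIter L (j + 1) W X'' = 0 → IsLandauB8 (d := d) L N (j + 1) W X'' →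
      ∀ g'' : ℝ, 0 ≤ g'' →
      (∀ Y : Site d → Fin d → Matrix n n ℂ, IsSkewDir Y → IsPeriodicDir Y ((N * L ^ (j + 1) : ℕ) : ℤ) → QbarIter L (j + 1) W Y = 0 →
        |hess W X'' Y (perWin d (N * L ^ (j + 1)))| ≤ g'' * dirL1 Y (periodBox (d := d) (N * L ^ (j + 1)))) →
      ∀ z μ' ν', μ' ≠ ν' → ‖curlAt W X'' z μ' ν'‖ ≤ KB * g'')
    -- (T1♯): an EXACT right inverse of the nested transported block mean with sup `C_a` and covariant-Laplacian sup `C_a′`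
    {Ca Ca' : ℝ}
    (hT : ∀ θ' : Site d → Matrix n n ℂ, (∀ z, θ' z ∈ skewAdjoint (Matrix n n ℂ)) → (∀ (z : Site d) (i : Fin d), θ' (z + (N : ℤ) • e i) = θ' z) →
      ∀ s : ℝ, (∀ z, ‖θ' z‖ ≤ s) →
      ∃ h₀ : Site d → Matrix n n ℂ, (∀ y, h₀ y ∈ skewAdjoint (Matrix n n ℂ)) ∧
        (∀ (y : Site d) (i : Fin d), h₀ (y + ((N * L ^ (j + 1) : ℕ) : ℤ) • e i) = h₀ y) ∧
        bmeanIterW L (j + 1) W h₀ = θ' ∧ (∀ y, ‖h₀ y‖ ≤ Ca * s) ∧ (∀ y, ‖covLapSite W h₀ y‖ ≤ Ca' * s))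
    (hcritW : ∀ Y : Site d → Fin d → Matrix n n ℂ, IsSkewDir Y → IsPeriodicDir Y ((N * L ^ (j + 1) : ℕ) : ℤ) → dirIter L (j + 1) W Y = 0 →
      dAction W Y (perWin d (N * L ^ (j + 1))) = 0) :
    SmallField U (x + ((KB * (1 + 2 * d * (2 * ((d : ℝ) * L) * Real.exp (((L : ℝ) ^ d / L) * ((d : ℝ) * (16 * ((d : ℝ) + 1) * ((d : ℝ) + 4) * (L : ℝ) ^ 2) * (1250 * ((nbRad d L : ℝ) + L) + 8 * ((d : ℝ) * L) + 2 * L)) * (2 / twoLevelSmall d L))))) * (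
        ((x + 4 * (Real.exp α₀ - 1))
            * ((curl1C d L / (1 - thetaLoc d L * (((L : ℝ) ^ (j + 1)) ^ 2 * (x + 4 * (Real.exp α₀ - 1)))))
                * (((L : ℝ) ^ (j + 1)) ^ d / ((L : ℝ) ^ (j + 1)) ^ 2))
            * (Real.exp (((L : ℝ) ^ d / L) * ((d : ℝ) * (16 * ((d : ℝ) + 1) * ((d : ℝ) + 4) * (L : ℝ) ^ 2)
                  * (1250 * ((nbRad d L : ℝ) + L) + 8 * ((d : ℝ) * L) + 2 * L)) * (2 / twoLevelSmall d L))
                * ((L : ℝ) / (L : ℝ) ^ d) ^ j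
                * (((d : ℝ) * (2 * nbRad d L + 1) ^ d) * ((2 * (d : ℝ) + 4) * (L : ℝ) ^ 2) * (2 * (L : ℝ) ^ j) * (Real.exp α₀ - 1)
                  + (17 / 8 * ((L : ℝ) ^ 2) ^ j * (x + 4 * (Real.exp α₀ - 1)))
                    * (((d : ℝ) * (2 * nbRad d L + 1) ^ d) * ((2 * (d : ℝ) + 4)
                          * (2 * (2 * L * (nbRad d L : ℝ) + 128 * ((d : ℝ) + 1) * ((d : ℝ) + 4) * (L : ℝ) ^ 2)))
                      + ((d : ℝ) * (2 * nbRad d L + 1) ^ d) * ((2 * (d : ℝ) + 4) * (L : ℝ) ^ 2 * (2 * (nbRad d L : ℝ))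
                          + 2 * (8 * (L : ℝ) + (1250 * ((nbRad d L : ℝ) + L) + 8 * (d * L) + 2 * L))
                              * (16 * ((d : ℝ) + 1) * ((d : ℝ) + 4) * (L : ℝ) ^ 2))))))
        + (Fintype.card (T4AveragingDeficitWall.Plane d) : ℝ)
          * (2 * (240 * (Real.exp α₀ - 1) * α₀ * (2 * ((4 * ((d : ℝ) * αE / ((L ^ (j + 1) : ℕ) : ℝ) + ((L ^ (j + 1) : ℕ) : ℝ) * ((((d : ℝ) - 1) * (2 * gU) + ((d : ℝ) - 1) * (2 * gW) + d * (2 * (Real.exp αE - 1) * xU + 2 * (xU * x) + 2 * (x * (2 + x) * x) + 2 * (xU * (2 + xU) * xU))) + 2 * (b₀ + 3 * (cRE * b₀)))) + (4 * ((L ^ (j + 1) : ℕ) : ℝ) * (8 * d * (Real.exp (4 * αE) - 1) * x + 10 * d * x + 2 * (2 * (d : ℝ) ^ 2 * (((L ^ (j + 1) : ℕ) : ℝ) + 1) * (2 * gW) + 8 * (d : ℝ) ^ 3 * (((L ^ (j + 1) : ℕ) : ℝ) + 1) ^ 2 * x ^ 2) + 12 * d * (2 * (d : ℝ) * (((L ^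 (j + 1) : ℕ) : ℝ) + 1) * x) ^ 2) + 4 * (2 * (d : ℝ) * (((L ^ (j + 1) : ℕ) : ℝ) + 1) * x)) * αE + 2 * x * αE) + 2 * δ + 2 * (4 * (2 * θu + δ) * (αE + δ))) + 24 * α₀ * (Real.exp α₀ - 1) + x) + 8 * α₀ * (2 * ((4 * ((d : ℝ) * αE / ((L ^ (j + 1) : ℕ) : ℝ) + ((L ^ (j + 1) : ℕ) : ℝ) * ((((d : ℝ) - 1) * (2 * gU) + ((d : ℝ) - 1) * (2 * gW) + d * (2 * (Real.exp αE - 1) * xU + 2 * (xU * x) + 2 * (x * (2 + x) * x) + 2 * (xU * (2 + xU) * xU))) + 2 * (b₀ + 3 * (cRE * b₀)))) + (4 * ((L ^ (j + 1) : ℕ) : ℝ) * (8 * d * (Real.exp (4 * αE) - 1) * x + 10 * d * x + 2 * (2 * (d : ℝ) ^ 2 * (((L ^ (j + 1) : ℕ) : ℝ) + 1) * (2 * gW) + 8 * (d : ℝ) ^ 3 * (((L ^ (j + 1) : ℕ) : ℝ) + 1) ^ 2 * x ^ 2) + 12 * d * (2 * (d : ℝ) * (((L ^ (j + 1) : ℕ)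 : ℝ) + 1) * x) ^ 2) + 4 * (2 * (d : ℝ) * (((L ^ (j + 1) : ℕ) : ℝ) + 1) * x)) * αE + 2 * x * αE) + 2 * δ + 2 * (4 * (2 * θu + δ) * (αE + δ))) + 24 * α₀ * (Real.exp α₀ - 1))
              + 6 * (Real.exp α₀ - 1) * (2 * ((4 * ((d : ℝ) * αE / ((L ^ (j + 1) : ℕ) : ℝ) + ((L ^ (j + 1) : ℕ) : ℝ) * ((((d : ℝ) - 1) * (2 * gU) + ((d : ℝ) - 1) * (2 * gW) + d * (2 * (Real.exp αE - 1) * xU + 2 * (xU * x) + 2 * (x * (2 + x) * x) + 2 * (xU * (2 + xU) * xU))) + 2 * (b₀ + 3 * (cRE * b₀)))) + (4 * ((L ^ (j + 1) : ℕ) : ℝ) * (8 * d * (Real.exp (4 * αE) - 1) * x + 10 * d * x + 2 * (2 * (d : ℝ) ^ 2 * (((L ^ (j + 1) : ℕ) : ℝ) + 1) * (2 * gW) + 8 * (d : ℝ) ^ 3 * (((L ^ (j + 1) : ℕ) : ℝ) + 1) ^ 2 * x ^ 2) + 12 * d * (2 * (d : ℝ) * (((L ^ (j + 1) : ℕ)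 : ℝ) + 1) * x) ^ 2) + 4 * (2 * (d : ℝ) * (((L ^ (j + 1) : ℕ) : ℝ) + 1) * x)) * αE + 2 * x * αE) + 2 * δ + 2 * (4 * (2 * θu + δ) * (αE + δ))) + 24 * (Real.exp α₀ - 1) * α₀)
              + (2 * ((4 * ((d : ℝ) * αE / ((L ^ (j + 1) : ℕ) : ℝ) + ((L ^ (j + 1) : ℕ) : ℝ) * ((((d : ℝ) - 1) * (2 * gU) + ((d : ℝ) - 1) * (2 * gW) + d * (2 * (Real.exp αE - 1) * xU + 2 * (xU * x) + 2 * (x * (2 + x) * x) + 2 * (xU * (2 + xU) * xU))) + 2 * (b₀ + 3 * (cRE * b₀)))) + (4 * ((L ^ (j + 1) : ℕ) : ℝ) * (8 * d * (Real.exp (4 * αE) - 1) * x + 10 * d * x + 2 * (2 * (d : ℝ) ^ 2 * (((L ^ (j + 1) : ℕ) : ℝ) + 1) * (2 * gW) + 8 * (d : ℝ) ^ 3 * (((L ^ (j + 1) : ℕ) : ℝ) + 1) ^ 2 * x ^ 2) + 12 * d * (2 * (d : ℝ) * (((L ^ (j + 1) : ℕ) : ℝ) + 1) * x) ^ 2)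 + 4 * (2 * (d : ℝ) * (((L ^ (j + 1) : ℕ) : ℝ) + 1) * x)) * αE + 2 * x * αE) + 2 * δ + 2 * (4 * (2 * θu + δ) * (αE + δ))) + 24 * (Real.exp α₀ - 1) * α₀) * (2 * ((4 * ((d : ℝ) * αE / ((L ^ (j + 1) : ℕ) : ℝ) + ((L ^ (j + 1) : ℕ) : ℝ) * ((((d : ℝ) - 1) * (2 * gU) + ((d : ℝ) - 1) * (2 * gW) + d * (2 * (Real.exp αE - 1) * xU + 2 * (xU * x) + 2 * (x * (2 + x) * x) + 2 * (xU * (2 + xU) * xU))) + 2 * (b₀ + 3 * (cRE * b₀)))) + (4 * ((L ^ (j + 1) : ℕ) : ℝ) * (8 * d * (Real.exp (4 * αE) - 1) * x + 10 * d * x + 2 * (2 * (d : ℝ) ^ 2 * (((L ^ (j + 1) : ℕ) : ℝ) + 1) * (2 * gW) + 8 * (d : ℝ) ^ 3 * (((L ^ (j + 1) : ℕ) : ℝ) + 1) ^ 2 * x ^ 2) + 12 * d * (2 * (d : ℝ) * (((L ^ (j + 1) : ℕ) : ℝ) + 1) * x) ^ 2) + 4 * (2 * (d : ℝ) * (((L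 ^ (j + 1) : ℕ) : ℝ) + 1) * x)) * αE + 2 * x * αE) + 2 * δ + 2 * (4 * (2 * θu + δ) * (αE + δ))) + 24 * α₀ * (Real.exp α₀ - 1))
              + 960 * (Real.exp α₀ - 1) * α₀ ^ 2 + 32 * x * α₀ ^ 2)
            + (64 * α₀ * ((4 * ((d : ℝ) * αE / ((L ^ (j + 1) : ℕ) : ℝ) + ((L ^ (j + 1) : ℕ) : ℝ) * ((((d : ℝ) - 1) * (2 * gU) + ((d : ℝ) - 1) * (2 * gW) + d * (2 * (Real.exp αE - 1) * xU + 2 * (xU * x) + 2 * (x * (2 + x) * x) + 2 * (xU * (2 + xU) * xU))) + 2 * (b₀ + 3 * (cRE * b₀)))) + (4 * ((L ^ (j + 1) : ℕ) : ℝ) * (8 * d * (Real.exp (4 * αE) - 1) * x + 10 * d * x + 2 * (2 * (d : ℝ) ^ 2 * (((L ^ (j + 1) : ℕ) : ℝ) + 1) * (2 * gW) + 8 * (d : ℝ) ^ 3 * (((L ^ (j + 1) : ℕ) : ℝ) + 1) ^ 2 * x ^ 2) + 12 * d * (2 * (d : ℝ) * (((L ^ (j + 1) : ℕ) : ℝ)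 + 1) * x) ^ 2) + 4 * (2 * (d : ℝ) * (((L ^ (j + 1) : ℕ) : ℝ) + 1) * x)) * αE + 2 * x * αE) + 2 * δ + 2 * (4 * (2 * θu + δ) * (αE + δ))) + 1024 * x * α₀ ^ 2))
        + ν) + (2 * d * KB * (2 * ((d : ℝ) * L) * Real.exp (((L : ℝ) ^ d / L) * ((d : ℝ) * (16 * ((d : ℝ) + 1) * ((d : ℝ) + 4) * (L : ℝ) ^ 2) * (1250 * ((nbRad d L : ℝ) + L) + 8 * ((d : ℝ) * L) + 2 * L)) * (2 / twoLevelSmall d L))) * ((d : ℝ) * gW + 12 * (Fintype.card (T4AveragingDeficitWall.Plane d) : ℝ) * x ^ 2)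
              + (2 * KB * ((d : ℝ) * gW + 12 * (Fintype.card (T4AveragingDeficitWall.Plane d) : ℝ) * x ^ 2) * (1 + 4 * d * (2 * ((d : ℝ) * L) * Real.exp (((L : ℝ) ^ d / L) * ((d : ℝ) * (16 * ((d : ℝ) + 1) * ((d : ℝ) + 4) * (L : ℝ) ^ 2) * (1250 * ((nbRad d L : ℝ) + L) + 8 * ((d : ℝ) * L) + 2 * L)) * (2 / twoLevelSmall d L)))) + 2 * x) * ((Ca + (36 * d * (frameC d L + d) ^ 2 * ((L : ℝ) ^ (j + 1)) ^ 2 * cRE) * Ca') * (6 * (d : ℝ) * (L : ℝ) ^ (j + 1)))) * (α₀ + aN)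
        + ((2 * KB * ((d : ℝ) * gW + 12 * (Fintype.card (T4AveragingDeficitWall.Plane d) : ℝ) * x ^ 2) * (1 + 4 * d * (2 * ((d : ℝ) * L) * Real.exp (((L : ℝ) ^ d / L) * ((d : ℝ) * (16 * ((d : ℝ) + 1) * ((d : ℝ) + 4) * (L : ℝ) ^ 2) * (1250 * ((nbRad d L : ℝ) + L) + 8 * ((d : ℝ) * L) + 2 * L)) * (2 / twoLevelSmall d L)))) + 2 * x) * (36 * d * (frameC d L + d) ^ 2 * ((L : ℝ) ^ (j + 1)) ^ 2 * cRE)) * (2 * (d : ℝ) * (4 * (2 * θu + δ) * (αE + δ)) + (b₀ + 3 * (cRE * b₀)) + 2 * (d : ℝ) * aN) 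
        + ((2 * KB * ((d : ℝ) * gW + 12 * (Fintype.card (T4AveragingDeficitWall.Plane d) : ℝ) * x ^ 2) * (1 + 4 * d * (2 * ((d : ℝ) * L) * Real.exp (((L : ℝ) ^ d / L) * ((d : ℝ) * (16 * ((d : ℝ) + 1) * ((d : ℝ) + 4) * (L : ℝ) ^ 2) * (1250 * ((nbRad d L : ℝ) + L) + 8 * ((d : ℝ) * L) + 2 * L)) * (2 / twoLevelSmall d L)))) + 2 * x) * (1 + (Ca + (36 * d * (frameC d L + d) ^ 2 * ((L : ℝ) ^ (j + 1)) ^ 2 * cRE) * Ca'))) * (2 * θu) + cN + 28 * α₀ ^ 2)) := by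
  have hgW0 : 0 ≤ gW :=
    (norm_nonneg _).trans (hgW 0 ⟨0, by omega⟩ ⟨(⟨0, by omega⟩, ⟨1, by omega⟩), Fin.mk_lt_mk.mpr zero_lt_one⟩)
  exact smallField_of_tanCritical_roadB_landauB8_corr_end hd hL j hWu hWP hx hs hWx hα0 hs' hθ hθl hε hUu hUP hxU hsU hUxU hcritU hTopUW hgW hgU hbx hcx hbx' hcx'
    hr₀ hb₀ hcRE hreg₁ hreg₂ hreg₃ hline hαE hθu hαE40 hθu160 hδ hδ40 hα₀ hs1 hA hσ0 haN hcN hνm hx4 hB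
    (harmonicExtensionRow_of_smoothRightInverse j hWu hWP hT
      (landauB8CorrectionLetter_of_fluxGrad (by omega) hL j hWu hWP hx hx4 hs hWx hgW0 hgW hbx hcx hcRE)) hcritW

end

end Summit.QuantumFields.BalabanUV.T4Continuum.NE7ApeCurvedRepRoadBSmoothInverseEnd
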